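import Literature.NumberTheory.Transcendental.LineODETheta
import HarnessLib

/-!
# Finitely many linear conditions forcing vanishing along `𝔟`: words in the line derivations

Topic: `Literature/NumberTheory/Transcendental`. Plan item W4 (Siegel step, algebraic half) of the
unit `provefact-Literature.NumberTheory.Transcendental.H-b596640137`. By the jet formula
(`LineODETheta.vanishesAlong_thetaEval_iff_der`) the vanishing of `F_P` to order `≥ T` at `w`
along a direction `x` is the vanishing of the values `(D_x^k (P∘HPoly))(gens(w))`, `k < T`, where
`D_x` is the derivation of `ℂ[Gen]` attached to `x` (`LineODEGens.genODE`). Since `x ↦ D_x` is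
LINEAR, for `x = ∑_m c_m x_m` in the span of finitely many directions
`D_x^k = ∑_{ω : Fin k → Fin d} c^ω D_{ω₀} ∘ ⋯ ∘ D_{ω_{k-1}}` (non-commutative multinomial
expansion, `PolyODE.iterate_sum_smul_apply`), and `c^ω = ∏_m c_m^{α_m}` only depends on the
content `α` of the word `ω`. Hence (`vanishesAlong_span_of_wordForms`): if for every `k < T` and
every content `α` the finitely many numbers

`Λ_{α}(P) = ∑_{ω of content α} (D_{ω₀} ∘ ⋯ ∘ D_{ω_{k-1}} (P∘HPoly))(gens(w))`

vanish, then `F_P` vanishes to order `≥ T` at `w` along the whole span `𝔟 = ⟨x_1, …, x_d⟩_ℂ`.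
These `Λ_α` are `ℂ`-linear in `P`; there are `≤ (S+1)·T^d`-many of them for the points
`s·v, s ≤ S` — the linear system of Baker's method (Baker–Wüstholz 2007, §6.8, p. 118: "at most
`S T^d h` equations"). Everything here is proved; no analysis beyond the jet formula is used.

## References

* A. Baker, G. Wüstholz, *Logarithmic Forms and Diophantine Geometry*, CUP 2007, §6.8.
-/

noncomputable section

open Complex MvPolynomial
open scoped PeriodPair

namespace Literature.NumberTheory.Transcendental

/-! ### Words in a family of linear maps -/

namespace PolyODE

section Words

variable {R M N ι' : Type*} [CommSemiring R] [AddCommMonoid M] [Module R M] [AddCommMonoid N]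
  [Module R N]

/-- The composite `D_{ω 0} ∘ D_{ω 1} ∘ ⋯ ∘ D_{ω (k-1)}` attached to a word `ω`. [folklore] -/
def wordApp (D : ι' → M →ₗ[R] M) : {k : ℕ} → (Fin k → ι') → M →ₗ[R] M
  | 0, _ => LinearMap.id
  | _ + 1, ω => D (ω 0) ∘ₗ wordApp D (Fin.tail ω)

omit [AddCommMonoid N] [Module R N] in
/-- The empty word acts as the identity. [folklore] -/
@[simp] theorem wordApp_zero (D : ι' → M →ₗ[R] M) (ω : Fin 0 → ι') (H : M) :
    wordApp D ω H = H := rfl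

omit [AddCommMonoid N] [Module R N] in
/-- `W_{m :: ω} = D_m ∘ W_ω`. [folklore] -/
@[simp] theorem wordApp_cons (D : ι' → M →ₗ[R] M) {k : ℕ} (m : ι') (ω : Fin k → ι') (H : M) :
    wordApp D (Fin.cons m ω : Fin (k + 1) → ι') H = D m (wordApp D ω H) := by
  simp [wordApp]

variable [Fintype ι']

omit [AddCommMonoid N] [Module R N] in
/-- **Non-commutative multinomial expansion**:
`(∑_m c_m D_m)^k H = ∑_{ω : Fin k → ι'} (∏_t c_{ω t}) • W_ω H`. [folklore] -/
theorem iterate_sum_smul_apply (D : ι' → M →ₗ[R] M) (c : ι' → R) (k : ℕ) (H : M) :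
    (⇑(∑ m, c m • D m))^[k] H = ∑ ω : Fin k → ι', (∏ t, c (ω t)) • wordApp D ω H := by
  induction k generalizing H with
  | zero => simp
  | succ k ih =>
    rw [Function.iterate_succ_apply', ih, map_sum]
    simp only [map_smul, LinearMap.sum_apply, LinearMap.smul_apply, Finset.smul_sum, smul_smul]
    -- reindex `Fin (k+1) → ι'` by `ι' × (Fin k → ι')`
    rw [← (Fin.consEquiv fun _ : Fin (k + 1) => ι').sum_comp, Fintype.sum_prod_type, Finset.sum_comm]
    refine Finset.sum_congr rfl fun ω _ => Finset.sum_congr rfl fun m _ => ?_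
    simp only [Fin.consEquiv, Equiv.coe_fn_mk, wordApp_cons, Fin.prod_univ_succ, Fin.cons_zero,
      Fin.cons_succ]
    ring_nf

/-- The content of a word: how often each letter occurs. [folklore] -/
def content [DecidableEq ι'] {k : ℕ} (ω : Fin k → ι') (m : ι') : ℕ :=
  (Finset.univ.filter fun t => ω t = m).card

omit [AddCommMonoid M] [Module R M] [AddCommMonoid N] [Module R N] [Fintype ι'] in
/-- The content is at most the length. [folklore] -/
theorem content_le [DecidableEq ι'] {k : ℕ} (ω : Fin k → ι') (m : ι') : content ω m ≤ k := by
  unfold content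
  exact (Finset.card_filter_le _ _).trans (by simp)

omit [AddCommMonoid M] [Module R M] [AddCommMonoid N] [Module R N] in
/-- `∏_t c_{ω t} = ∏_m c_m^{α_m}`, `α` the content. [folklore] -/
theorem prod_word_eq_prod_pow_content [DecidableEq ι'] (c : ι' → R) {k : ℕ} (ω : Fin k → ι') :
    ∏ t, c (ω t) = ∏ m, c m ^ content ω m := by
  rw [← Finset.prod_fiberwise_of_maps_to (g := ω) (fun t _ => Finset.mem_univ (ω t))]
  refine Finset.prod_congr rfl fun m _ => ?_
  rw [Finset.prod_congr rfl fun t ht => by rw [(Finset.mem_filter.mp ht).2], Finset.prod_const]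
  rfl

/-- **Grouping by content.** If, for every content `α ≤ k`, the sum of `φ(W_ω H)` over the words
of content `α` vanishes, then `φ((∑_m c_m D_m)^k H) = 0` for ALL coefficient vectors `c`.
[folklore] -/
theorem apply_iterate_sum_smul_eq_zero [DecidableEq ι'] (D : ι' → M →ₗ[R] M) (k : ℕ) (H : M)
    (φ : M →ₗ[R] N)
    (h : ∀ α : ι' → Fin (k + 1),
      ∑ ω ∈ Finset.univ.filter (fun ω : Fin k → ι' => ∀ m, content ω m = α m), φ (wordApp D ω H) = 0)
    (c : ι' → R) : φ ((⇑(∑ m, c m • D m))^[k] H) = 0 := by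
  rw [iterate_sum_smul_apply, map_sum]
  simp only [map_smul]
  -- group the words by their content
  let cont : (Fin k → ι') → ι' → Fin (k + 1) := fun ω m => ⟨content ω m, Nat.lt_succ_of_le (content_le ω m)⟩
  rw [← Finset.sum_fiberwise_of_maps_to (g := cont) (fun ω _ => Finset.mem_univ (cont ω))]
  refine Finset.sum_eq_zero fun α _ => ?_
  have hc : ∀ ω ∈ Finset.univ.filter (fun ω => cont ω = α),
      (∏ t, c (ω t)) • φ (wordApp D ω H) = (∏ m, c m ^ (α m : ℕ)) • φ (wordApp D ω H) := by
    intro ω hω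
    rw [prod_word_eq_prod_pow_content]
    have hωα : cont ω = α := (Finset.mem_filter.mp hω).2
    congr 2
    funext m
    rw [← hωα]
  rw [Finset.sum_congr rfl hc, ← Finset.smul_sum]
  have hset : Finset.univ.filter (fun ω => cont ω = α) =
      Finset.univ.filter (fun ω : Fin k → ι' => ∀ m, content ω m = α m) := by
    ext ω
    simp only [Finset.mem_filter, Finset.mem_univ, true_and, cont, funext_iff, Fin.ext_iff]
  rw [hset, h α, smul_zero]

end Words

end PolyODE

/-- Coercion of a finite linear combination of derivations to functions. [folklore] -/
theorem _root_.Derivation.coe_sum_smul {ι σ R : Type*} [CommRing R] (s : Finset ι) (c : ι → R)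
    (D : ι → Derivation R (MvPolynomial σ R) (MvPolynomial σ R)) :
    ⇑(∑ i ∈ s, c i • D i) = ∑ i ∈ s, c i • ⇑(D i) := by
  induction s using Finset.cons_induction with
  | empty => simp
  | cons a s ha ih => rw [Finset.sum_cons, Finset.sum_cons, Derivation.coe_add, Derivation.coe_smul, ih]

/-! ### The linear conditions in the setting of `M_κ` -/

namespace GaGmE

namespace Std

variable {β γ δ : Type} [Fintype β] [Fintype γ] [Fintype δ] [DecidableEq γ]
variable (L : PeriodPair) (κM : δ → γ → Kbar)

omit [Fintype β] [Fintype δ] [DecidableEq γ] in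
/-- The line derivation data is additive in the direction. [folklore] -/
theorem genODE_add (c : γ → Bool) (x x' : β ⊕ (γ ⊕ δ) → ℂ) (i : Gen β γ δ) :
    genODE L κM c (x + x') i = genODE L κM c x i + genODE L κM c x' i := by
  rcases i with j | ⟨b, i⟩ | e
  · simp only [genODE, Pi.add_apply, map_add]; ring
  · simp only [genODE, Pi.add_apply, map_add]; ring
  · simp only [genODE, Pi.add_apply, map_add, mul_add, add_mul, Finset.sum_add_distrib]; ring

omit [Fintype β] [Fintype δ] [DecidableEq γ] in
/-- The line derivation data is homogeneous in the direction. [folklore] -/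
theorem genODE_smul (c : γ → Bool) (a : ℂ) (x : β ⊕ (γ ⊕ δ) → ℂ) (i : Gen β γ δ) :
    genODE L κM c (a • x) i = a • genODE L κM c x i := by
  rcases i with j | ⟨b, i⟩ | e
  · simp only [genODE, Pi.smul_apply, smul_eq_mul, map_mul, smul_eq_C_mul]; ring
  · simp only [genODE, Pi.smul_apply, smul_eq_mul, map_mul, smul_eq_C_mul]; ring
  · simp only [genODE, Pi.smul_apply, smul_eq_mul, map_mul, smul_eq_C_mul, Finset.mul_sum, mul_sub]
    congr 1
    exact Finset.sum_congr rfl fun b _ => by ring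

/-- `x ↦ genODE c x i` as a linear map. [folklore] -/
def genODEₗ (c : γ → Bool) (i : Gen β γ δ) : (β ⊕ (γ ⊕ δ) → ℂ) →ₗ[ℂ] MvPolynomial (Gen β γ δ) ℂ where
  toFun x := genODE L κM c x i
  map_add' x x' := genODE_add L κM c x x' i
  map_smul' a x := genODE_smul L κM c a x i

omit [Fintype β] [Fintype δ] [DecidableEq γ] in
/-- The line derivation data is linear in the direction. [folklore] -/
theorem genODE_sum_smul {d : ℕ} (c : γ → Bool) (cs : Fin d → ℂ) (xs : Fin d → β ⊕ (γ ⊕ δ) → ℂ)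
    (i : Gen β γ δ) :
    genODE L κM c (∑ m, cs m • xs m) i = ∑ m, cs m • genODE L κM c (xs m) i := by
  have := map_sum (genODEₗ L κM c i) (fun m => cs m • xs m) Finset.univ
  simpa only [map_smul, genODEₗ, LinearMap.coe_mk, AddHom.coe_mk] using this

omit [Fintype β] [Fintype δ] [DecidableEq γ] in
/-- Hence the derivation `D_x` is linear in `x`: `D_{∑ c_m x_m} = ∑ c_m D_{x_m}`. [folklore] -/
theorem der_genODE_sum_smul {d : ℕ} (c : γ → Bool) (cs : Fin d → ℂ)
    (xs : Fin d → β ⊕ (γ ⊕ δ) → ℂ) :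
    PolyODE.der (genODE L κM c (∑ m, cs m • xs m)) =
      ∑ m, cs m • PolyODE.der (genODE L κM c (xs m)) := by
  refine MvPolynomial.derivation_ext fun i => ?_
  rw [PolyODE.der_X, genODE_sum_smul, Derivation.coe_sum_smul, Finset.sum_apply]
  exact Finset.sum_congr rfl fun m _ => by rw [Pi.smul_apply, PolyODE.der_X]

/-- **The word forms** `Λ_ω(P) = (D_{ω₀} ∘ ⋯ ∘ D_{ω_{k-1}} (P ∘ HPoly))(gens(w))` of a polynomial
`P` at the point `w`, for a chart choice `c` and directions `x_1, …, x_d`; `ℂ`-linear in `P`.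
[cite: BakerWustholz2007, §6.8 (p. 118)] -/
def wordForm {d : ℕ} (c : γ → Bool) (xs : Fin d → β ⊕ (γ ⊕ δ) → ℂ) (w : β ⊕ (γ ⊕ δ) → ℂ)
    {k : ℕ} (ω : Fin k → Fin d) (P : MvPolynomial (Option β × ThetaIdx γ δ) ℂ) : ℂ :=
  MvPolynomial.eval (genFun L κM c w 0 0)
    (PolyODE.wordApp (fun m => (PolyODE.der (genODE L κM c (xs m))).toLinearMap) ω
      (MvPolynomial.bind₁ (HPoly L κM c) P))

omit [Fintype β] [Fintype δ] in
/-- The word forms are additive in `P`. [folklore] -/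
theorem wordForm_add {d : ℕ} (c : γ → Bool) (xs : Fin d → β ⊕ (γ ⊕ δ) → ℂ)
    (w : β ⊕ (γ ⊕ δ) → ℂ) {k : ℕ} (ω : Fin k → Fin d) (P Q : MvPolynomial (Option β × ThetaIdx γ δ) ℂ) :
    wordForm L κM c xs w ω (P + Q) = wordForm L κM c xs w ω P + wordForm L κM c xs w ω Q := by
  simp [wordForm, map_add]

omit [Fintype β] [Fintype δ] in
/-- The word forms are homogeneous in `P`. [folklore] -/
theorem wordForm_smul {d : ℕ} (c : γ → Bool) (xs : Fin d → β ⊕ (γ ⊕ δ) → ℂ)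
    (w : β ⊕ (γ ⊕ δ) → ℂ) {k : ℕ} (ω : Fin k → Fin d) (a : ℂ) (P : MvPolynomial (Option β × ThetaIdx γ δ) ℂ) :
    wordForm L κM c xs w ω (a • P) = a * wordForm L κM c xs w ω P := by
  simp only [wordForm, map_smul, MvPolynomial.smul_eval]

/-- **Finitely many linear conditions force vanishing along the span.** Let `P` be a form of
degree `D`, `w` a point with a chart choice `c` valid at `w`, and `x_1, …, x_d` directions. If
for every `k < T` and every content `α` the sum of the word forms `Λ_ω(P)` over the words
`ω : Fin k → Fin d` of content `α` vanishes, then `F_P` vanishes to order `≥ T` at `w` along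
`𝔟 = span{x_m}`. [cite: BakerWustholz2007, §6.8 (p. 118)] -/
theorem vanishesAlong_span_of_wordForms {P : MvPolynomial (Option β × ThetaIdx γ δ) ℂ} {D : ℕ}
    (hP : P.IsHomogeneous D) (c : γ → Bool) {w : β ⊕ (γ ⊕ δ) → ℂ}
    (hc : ∀ x : β ⊕ (γ ⊕ δ) → ℂ, (0 : ℂ) ∈ chartDomain L c w x) {d : ℕ}
    (xs : Fin d → β ⊕ (γ ⊕ δ) → ℂ) (T : ℕ)
    (h : ∀ k < T, ∀ α : Fin d → Fin (k + 1),
      ∑ ω ∈ Finset.univ.filter (fun ω : Fin k → Fin d => ∀ m, PolyODE.content ω m = α m),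
        wordForm L κM c xs w ω P = 0) :
    VanishesAlong (Submodule.span ℂ (Set.range xs)) (thetaEval L κM P) w T := by
  rw [vanishesAlong_thetaEval_iff_der κM hP c _ hc T]
  intro x hx k hk
  obtain ⟨cs, rfl⟩ := Submodule.mem_span_range_iff_exists_fun ℂ |>.mp hx
  -- `gens(w)` does not depend on the direction
  have hg : genFun L κM c w (∑ m, cs m • xs m) 0 = genFun L κM c w 0 0 := by
    funext i; rcases i with j | ⟨b, i⟩ | e <;> simp [genFun]
  rw [hg, der_genODE_sum_smul]
  -- the derivation sum, as a function, is the sum of the linear maps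
  set Dm : Fin d → MvPolynomial (Gen β γ δ) ℂ →ₗ[ℂ] MvPolynomial (Gen β γ δ) ℂ :=
    fun m => (PolyODE.der (genODE L κM c (xs m))).toLinearMap with hDm
  have hfun : (⇑(∑ m, cs m • PolyODE.der (genODE L κM c (xs m))) :
      MvPolynomial (Gen β γ δ) ℂ → MvPolynomial (Gen β γ δ) ℂ) = ⇑(∑ m, cs m • Dm m) := by
    rw [Derivation.coe_sum_smul, LinearMap.coe_sum]
    exact Finset.sum_congr rfl fun m _ => by rw [LinearMap.coe_smul, hDm, Derivation.coeFn_coe]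
  rw [hfun]
  have key := PolyODE.apply_iterate_sum_smul_eq_zero Dm k (MvPolynomial.bind₁ (HPoly L κM c) P)
    (MvPolynomial.aeval (genFun L κM c w 0 0)).toLinearMap (fun α => ?_) cs
  · simpa [MvPolynomial.coe_aeval_eq_eval] using key
  · have := h k hk α
    simp only [wordForm] at this
    convert this using 2 with ω
    · ext ω'
      simp
    · simp [hDm]

end Std

end GaGmE

end Literature.NumberTheory.Transcendental

end
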